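import Summits.QuantumAdvantage.QuantumAdvantage.Theorems.SosSandwichPseudoBoundedAALevelTwoRung
import Summits.QuantumAdvantage.QuantumAdvantage.Theorems.SosSandwichQuerySecondLevelInfluence
import HarnessLib

/-!
# Route `SosSandwich`, crux `PseudoBoundedAA` (stmt-QuantumAdvantage-15237): `AA_Q` for TWO queries with the
# SHARP exponent — every Fourier level of a two-query acceptance polynomial carries a rung

The live analytic crux of route SosSandwich is `AA_Q`: every `T ≥ 1`-query quantum acceptance polynomial with
`Var ≥ ε > 0` has a variable with `Inf_i ≥ C (ε/T)^c`, constants uniform in `T`; any admissible exponent has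
`c ≥ 2` (`MeanSquare.aaQuery_exponent_ge_two`), and the tree knows `AA_Q` for boundedly many queries only through
the Dinur–Friedgut–Kindler–O'Donnell bound (`QueryPathBridge.aaQuery_of_queries_le`: `Inf ≥ ε^a / 2^{2CT₀}` with
the DFKO exponent `a`).  The rungs now in the tree cover EVERY Fourier level of a two-query acceptance polynomial
(degree `≤ 4`): level `1` (`LevelOneRung.exists_influence_ge_levelOne`, `16 W₁² ≤ d² Inf`), level `2`
(`LevelTwoRung.exists_influence_ge_levelTwo`, `16 W₂² ≤ 9 d⁶ Inf`), levels `3, 4 = 2T-1, 2T`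
(`QueryTopLevel.twoTopLevels_rung_robust`, `η² Var² ≤ 16 Inf` when `η·Var ≤ W₃ + W₄`).  Hence:

* `aaQuery_of_extremeLevels_share` — for ANY `T ≥ 2`: if the extreme levels `1, 2, 2T-1, 2T` carry the share
  `η` of the variance then `η²·Var[p]² ≤ 576·T⁶·maxᵢ Infᵢ[p]` — the open content of `AA_Q` is exactly the
  MIDDLE levels `3 … 2T-2`;
* `aaQuery_two_queries` — **the Aaronson–Ambainis conjecture for two-query quantum algorithms, sharp form**:
  `Var[p]² ≤ 36864 · maxᵢ Infᵢ[p]` for the acceptance polynomial `p` of ANY `2`-query quantum algorithm on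
  `N ≥ 1` bits (`Var ≤ W₁ + W₂ + W₃ + W₄`; one of `W₁ ≥ Var/4`, `W₂ ≥ Var/4`, `W₃ + W₄ ≥ Var/2`);
* `aaQuery_one_query_levels` — the same at `T = 1` from the two bottom rungs alone: `Var² ≤ 144 · maxᵢ Infᵢ`;
* `aaQuery_of_queries_le_two` — **`AA_Q` restricted to `T ≤ 2` holds with `(c, C) = (2, 1/9216)`**, the
  optimal exponent (shape of the hypothesis of `QueryRestrict.quantumQuerySimulable_of_aaQuery` /
  `QueryPathBridge.pathBound_of_aaQuery_of_bridge` on the sub-class `T ≤ 2`).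

What remains open for the crux is `T ≥ 3`: the middle levels `3 … 2T-2` have no polynomial-loss rung (a level-`k`
rung from the bottom costs `3^k·d^{O(k)}` along the present route — Bonami's constant and the `k`-th coefficient
bound; the Bohnenblust–Hille obstruction of arXiv:2608.04411 §1).

Honest label: support lemma (the crux on the sub-class `T ≤ 2`, unconditionally); no stub, crux or summit is proved.
Sources: O'Donnell 2014 §1.4, Thm. 9.21; Korneichuk 1991 §3.5.4; Beals et al. 2001 Lemma 4.1; Aaronson–Ambainis
2014 Conj. 6; Escudero Gutiérrez 2023 (arXiv:2304.06713) Thm. 1.4.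
-/

-- D-0017: single-conjunct summit ⇒ the duplicate `QuantumAdvantage.QuantumAdvantage` is mandated.
set_option linter.dupNamespace false

noncomputable section

namespace Summit.QuantumAdvantage.QuantumAdvantage.Theorems.SosSandwich.LevelTwoRung

open Finset
open Literature.Computability.QuantumComplexity
open Literature.Computability.Complexity.LowDegree (cubeFourierCoeff)
open Literature.Computability.Cryptography (QQueryAlg)
open Summit.QuantumAdvantage.QuantumAdvantage.Theorems.SosSandwich.LevelOneRung
open Summit.QuantumAdvantage.QuantumAdvantage.Theorems.SosSandwich.QueryTopLevel (twoTopLevels_rung_robust)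

variable {N : ℕ}

/-! ### The variance of a degree-`≤ 4` cube function splits into the levels `1 … 4` -/

/-- For a cube function of Fourier degree `≤ 4`: `Var[p] ≤ W₁ + W₂ + W₃ + W₄` (`Var = Σ_{S ≠ ∅} p̂(S)²`, and
the levels above `4` are empty; in fact equality). [cite: ODonnell2014, §1.4 (Parseval)] -/
theorem boolVariance_le_four_levels (p : MvPolynomial (Fin N) ℝ)
    (h4 : ∀ S : Finset (Fin N), 4 < S.card → cubeFourierCoeff (evalBool p) S = 0) :
    boolVariance p ≤
      (∑ S ∈ univ.filter (fun S : Finset (Fin N) => S.card = 1), cubeFourierCoeff (evalBool p) S ^ 2) +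
      (∑ S ∈ univ.filter (fun S : Finset (Fin N) => S.card = 2), cubeFourierCoeff (evalBool p) S ^ 2) +
      (∑ S ∈ univ.filter (fun S : Finset (Fin N) => S.card = 3), cubeFourierCoeff (evalBool p) S ^ 2) +
      (∑ S ∈ univ.filter (fun S : Finset (Fin N) => S.card = 4), cubeFourierCoeff (evalBool p) S ^ 2) := by
  rw [boolVariance_eq_sum_sq_fourier, Finset.sum_filter, Finset.sum_filter, Finset.sum_filter, Finset.sum_filter,
    ← Finset.sum_add_distrib, ← Finset.sum_add_distrib, ← Finset.sum_add_distrib]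
  refine Finset.sum_le_sum fun S _ => ?_
  by_cases h0 : S = ∅
  · subst h0; simp
  · rw [if_neg h0]
    by_cases h5 : 4 < S.card
    · rw [h4 S h5]
      have h1 : ¬ S.card = 1 := by omega
      have h2 : ¬ S.card = 2 := by omega
      have h3 : ¬ S.card = 3 := by omega
      have h4' : ¬ S.card = 4 := by omega
      simp [h1, h2, h3, h4']
    · have hpos : 0 < S.card := Finset.card_pos.mpr (Finset.nonempty_of_ne_empty h0)
      have hsq : 0 ≤ cubeFourierCoeff (evalBool p) S ^ 2 := sq_nonneg _
      have hc : S.card = 1 ∨ S.card = 2 ∨ S.card = 3 ∨ S.card = 4 := by omega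
      rcases hc with h | h | h | h <;> simp [h]

/-- The acceptance polynomial of a `T`-query algorithm has no Fourier weight above level `2T`.
[cite: BealsEtAl2001, Lemma 4.1] -/
theorem cubeFourierCoeff_acceptPoly_eq_zero (A : QQueryAlg N) (p : MvPolynomial (Fin N) ℝ)
    (hp : ∀ x, evalBool p x = A.acceptProb x) {S : Finset (Fin N)} (hS : 2 * A.queries < S.card) :
    cubeFourierCoeff (evalBool p) S = 0 := by
  obtain ⟨p₀, hdeg, hval⟩ := exists_acceptPolynomial A
  have heq : evalBool p = evalBool p₀ := funext fun x => by rw [hp x]; exact hval x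
  rw [heq]
  exact cubeFourierCoeff_evalBool_eq_zero hdeg hS

/-- The acceptance polynomial of a query algorithm is `[0,1]`-bounded on the cube. [cite: BealsEtAl2001, Lemma 4.1] -/
theorem acceptPoly_bounded (A : QQueryAlg N) (p : MvPolynomial (Fin N) ℝ)
    (hp : ∀ x, evalBool p x = A.acceptProb x) (x : Fin N → Bool) : 0 ≤ evalBool p x ∧ evalBool p x ≤ 1 := by
  rw [hp x]
  exact ⟨A.acceptProb_nonneg x, A.acceptProb_le_one' x⟩

/-- The level-1 weight as a sum over variables: `Σ_{|S|=1} a(S) = Σ_j a({j})`. [folklore] -/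
theorem sum_card_one_eq (a : Finset (Fin N) → ℝ) :
    ∑ S ∈ univ.filter (fun S : Finset (Fin N) => S.card = 1), a S = ∑ j : Fin N, a {j} := by
  rw [Finset.sum_filter]
  refine Eq.trans (Finset.sum_congr rfl fun S _ => ?_) (sum_ite_one_eq_card a)
  by_cases h : S.card = 1
  · rw [if_pos h, if_pos h.symm]
  · rw [if_neg h, if_neg (fun h' => h h'.symm)]

/-! ### `AA_Q` at `T = 2` and `T = 1`, sharp exponent -/

/-- **`AA_Q` on the share of the variance carried by the EXTREME levels `1, 2, 2T-1, 2T`.**  For every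
quantum algorithm making `T ≥ 2` queries to `N ≥ 1` bits, every real polynomial `p` with its acceptance
probabilities as cube values and every `η ≥ 0`: if `η·Var[p] ≤ W₁ + W₂ + W_{2T-1} + W_{2T}`, then some variable
has `η²·Var[p]² ≤ 576·T⁶·Inf_i[p]` — one of `W₁ ≥ ηVar/4` (level-one rung, `16 W₁² ≤ (2T)² Inf`),
`W₂ ≥ ηVar/4` (level-two rung, `16 W₂² ≤ 9 (2T)⁶ Inf`), `W_{2T-1} + W_{2T} ≥ ηVar/2` (top-two-levels rung,
`(η/2)² Var² ≤ 16 Inf`).  So the open content of the crux `AA_Q` is the MIDDLE levels `3 … 2T-2`.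
[cite: AaronsonAmbainis2014, Conj. 6] [cite: ODonnell2014, Thm. 9.21] [cite: Korneichuk1991, Prop 3.5.7 (§3.5.4)] -/
theorem aaQuery_of_extremeLevels_share (hN : 0 < N) (A : QQueryAlg N) (hT : 2 ≤ A.queries)
    (p : MvPolynomial (Fin N) ℝ) (hp : ∀ x, evalBool p x = A.acceptProb x) {η : ℝ} (hη : 0 ≤ η)
    (hmass : η * boolVariance p ≤
      (∑ S ∈ univ.filter (fun S : Finset (Fin N) => S.card = 1), cubeFourierCoeff (evalBool p) S ^ 2) +
      (∑ S ∈ univ.filter (fun S : Finset (Fin N) => S.card = 2), cubeFourierCoeff (evalBool p) S ^ 2) +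
      ((∑ S ∈ univ.filter (fun S : Finset (Fin N) => S.card = 2 * A.queries), cubeFourierCoeff (evalBool p) S ^ 2) +
        ∑ S ∈ univ.filter (fun S : Finset (Fin N) => S.card = 2 * A.queries - 1),
          cubeFourierCoeff (evalBool p) S ^ 2)) :
    ∃ i : Fin N, η ^ 2 * boolVariance p ^ 2 ≤ 576 * (A.queries : ℝ) ^ 6 * influence i p := by
  set W1 := ∑ S ∈ univ.filter (fun S : Finset (Fin N) => S.card = 1), cubeFourierCoeff (evalBool p) S ^ 2 with hW1
  set W2 := ∑ S ∈ univ.filter (fun S : Finset (Fin N) => S.card = 2), cubeFourierCoeff (evalBool p) S ^ 2 with hW2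
  set Wtop := (∑ S ∈ univ.filter (fun S : Finset (Fin N) => S.card = 2 * A.queries),
      cubeFourierCoeff (evalBool p) S ^ 2) +
    ∑ S ∈ univ.filter (fun S : Finset (Fin N) => S.card = 2 * A.queries - 1), cubeFourierCoeff (evalBool p) S ^ 2
    with hWtop
  have hV0 : 0 ≤ boolVariance p := boolVariance_nonneg p
  have hηV : 0 ≤ η * boolVariance p := mul_nonneg hη hV0
  have hT1 : (1 : ℝ) ≤ A.queries := by exact_mod_cast (show 1 ≤ A.queries by omega)
  have hT6 : (1 : ℝ) ≤ (A.queries : ℝ) ^ 6 := one_le_pow₀ hT1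
  -- degree `≤ 2T` and boundedness through the Beals et al. representative
  obtain ⟨p₀, hdeg, hval⟩ := exists_acceptPolynomial A
  have heq : evalBool p = evalBool p₀ := funext fun x => by rw [hp x]; exact hval x
  have hb : ∀ x, 0 ≤ evalBool p₀ x ∧ evalBool p₀ x ≤ 1 := fun x => by
    rw [← congrFun heq x]; exact acceptPoly_bounded A p hp x
  have hinf : ∀ i, influence i p₀ = influence i p := fun i => by unfold influence; rw [heq]
  by_cases h1 : η * boolVariance p ≤ 4 * W1
  · -- level-one rung with `d = 2T`
    obtain ⟨i, hi⟩ := exists_influence_ge_levelOne hN hdeg hb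
    rw [← heq, hinf, ← sum_card_one_eq (fun S => cubeFourierCoeff (evalBool p) S ^ 2)] at hi
    refine ⟨i, ?_⟩
    have hsq : (η * boolVariance p) ^ 2 ≤ (4 * W1) ^ 2 := pow_le_pow_left₀ hηV h1 2
    have hI := influence_nonneg i p
    push_cast at hi
    have h16 : 16 * W1 ^ 2 ≤ 4 * (A.queries : ℝ) ^ 2 * influence i p := by linarith
    have hT2 : (A.queries : ℝ) ^ 2 ≤ (A.queries : ℝ) ^ 6 :=
      pow_le_pow_right₀ hT1 (by norm_num)
    nlinarith [hsq, h16, mul_le_mul_of_nonneg_right hT2 hI]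
  by_cases h2 : η * boolVariance p ≤ 4 * W2
  · -- level-two rung with `d = 2T`
    obtain ⟨i, hi⟩ := exists_influence_ge_levelTwo hN hdeg hb
    rw [← heq, hinf] at hi
    refine ⟨i, ?_⟩
    have hsq : (η * boolVariance p) ^ 2 ≤ (4 * W2) ^ 2 := pow_le_pow_left₀ hηV h2 2
    push_cast at hi
    nlinarith [hi, hsq, influence_nonneg i p]
  -- the top two levels carry at least half of `η·Var`
  push Not at h1 h2
  have htop : (η / 2) * boolVariance p ≤ Wtop := by linarith
  obtain ⟨i, hi⟩ := twoTopLevels_rung_robust A hT p hp (by positivity : (0 : ℝ) ≤ η / 2) htop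
  refine ⟨i, ?_⟩
  have hI := influence_nonneg i p
  nlinarith [hi, hI, mul_le_mul_of_nonneg_right hT6 hI]

/-- **The Aaronson–Ambainis conjecture for TWO-query quantum algorithms, sharp form.**  For every quantum
algorithm making exactly `2` queries to `N ≥ 1` bits and every real polynomial `p` with its acceptance
probabilities as cube values, some variable has `Var[p]² ≤ 36864 · Inf_i[p]` (exponent `2`, optimal by
`MeanSquare.aaQuery_exponent_ge_two`): at `T = 2` every level `1 … 4` is extreme, `Var ≤ W₁ + W₂ + W₃ + W₄`.
[cite: AaronsonAmbainis2014, Conj. 6] [cite: ODonnell2014, Thm. 9.21] [cite: Korneichuk1991, Prop 3.5.7 (§3.5.4)] -/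
theorem aaQuery_two_queries (hN : 0 < N) (A : QQueryAlg N) (hT : A.queries = 2) (p : MvPolynomial (Fin N) ℝ)
    (hp : ∀ x, evalBool p x = A.acceptProb x) :
    ∃ i : Fin N, boolVariance p ^ 2 ≤ 36864 * influence i p := by
  have hsplit := boolVariance_le_four_levels p fun S hS => cubeFourierCoeff_acceptPoly_eq_zero A p hp (by omega)
  have hmass : (1 : ℝ) * boolVariance p ≤
      (∑ S ∈ univ.filter (fun S : Finset (Fin N) => S.card = 1), cubeFourierCoeff (evalBool p) S ^ 2) +
      (∑ S ∈ univ.filter (fun S : Finset (Fin N) => S.card = 2), cubeFourierCoeff (evalBool p) S ^ 2) +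
      ((∑ S ∈ univ.filter (fun S : Finset (Fin N) => S.card = 2 * A.queries), cubeFourierCoeff (evalBool p) S ^ 2) +
        ∑ S ∈ univ.filter (fun S : Finset (Fin N) => S.card = 2 * A.queries - 1),
          cubeFourierCoeff (evalBool p) S ^ 2) := by
    have e4 : 2 * A.queries = 4 := by omega
    have e3 : 2 * A.queries - 1 = 3 := by omega
    rw [e3, e4]
    linarith
  obtain ⟨i, hi⟩ := aaQuery_of_extremeLevels_share hN A (by omega) p hp zero_le_one hmass
  refine ⟨i, ?_⟩
  rw [hT] at hi
  push_cast at hi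
  linarith

/-- **`AA_Q` at `T = 1` from the two bottom rungs alone**: for a one-query algorithm (`Var ≤ W₁ + W₂`, degree
`≤ 2`), `Var[p]² ≤ 144 · maxᵢ Infᵢ[p]` (the tree's `OneQueryFrameAA` has the better constant `9/4`; this is the
rung-uniform derivation). [cite: AaronsonAmbainis2014, Conj. 6] [cite: ODonnell2014, Thm. 9.21] -/
theorem aaQuery_one_query_levels (hN : 0 < N) (A : QQueryAlg N) (hT : A.queries = 1)
    (p : MvPolynomial (Fin N) ℝ) (hp : ∀ x, evalBool p x = A.acceptProb x) :
    ∃ i : Fin N, boolVariance p ^ 2 ≤ 144 * influence i p := by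
  set W1 := ∑ S ∈ univ.filter (fun S : Finset (Fin N) => S.card = 1), cubeFourierCoeff (evalBool p) S ^ 2 with hW1
  set W2 := ∑ S ∈ univ.filter (fun S : Finset (Fin N) => S.card = 2), cubeFourierCoeff (evalBool p) S ^ 2 with hW2
  have hV0 : 0 ≤ boolVariance p := boolVariance_nonneg p
  obtain ⟨p₀, hdeg, hval⟩ := exists_acceptPolynomial A
  have heq : evalBool p = evalBool p₀ := funext fun x => by rw [hp x]; exact hval x
  have hdeg2 : p₀.totalDegree ≤ 2 := by rw [hT] at hdeg; exact hdeg
  have hb : ∀ x, 0 ≤ evalBool p₀ x ∧ evalBool p₀ x ≤ 1 := fun x => by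
    rw [← congrFun heq x]; exact acceptPoly_bounded A p hp x
  have hinf : ∀ i, influence i p₀ = influence i p := fun i => by unfold influence; rw [heq]
  have hzero : ∀ k, 2 < k →
      ∑ S ∈ univ.filter (fun S : Finset (Fin N) => S.card = k), cubeFourierCoeff (evalBool p) S ^ 2 = 0 := by
    intro k hk
    refine Finset.sum_eq_zero fun S hS => ?_
    rw [Finset.mem_filter] at hS
    rw [cubeFourierCoeff_acceptPoly_eq_zero A p hp (by omega), zero_pow two_ne_zero]
  have hsplit : boolVariance p ≤ W1 + W2 := by
    have h := boolVariance_le_four_levels p fun S hS => cubeFourierCoeff_acceptPoly_eq_zero A p hp (by omega)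
    rw [hzero 3 (by norm_num), hzero 4 (by norm_num)] at h
    linarith
  by_cases h1 : boolVariance p ≤ 2 * W1
  · obtain ⟨i, hi⟩ := exists_influence_ge_levelOne hN hdeg2 hb
    rw [← heq, hinf] at hi
    have hW1' : W1 = ∑ j : Fin N, cubeFourierCoeff (evalBool p) {j} ^ 2 :=
      sum_card_one_eq (fun S => cubeFourierCoeff (evalBool p) S ^ 2)
    rw [← hW1'] at hi
    refine ⟨i, ?_⟩
    have hsq : boolVariance p ^ 2 ≤ (2 * W1) ^ 2 := pow_le_pow_left₀ hV0 h1 2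
    push_cast at hi
    nlinarith [hi, hsq, influence_nonneg i p]
  · push Not at h1
    have h2 : boolVariance p ≤ 2 * W2 := by linarith
    obtain ⟨i, hi⟩ := exists_influence_ge_levelTwo hN hdeg2 hb
    rw [← heq, hinf] at hi
    refine ⟨i, ?_⟩
    have hsq : boolVariance p ^ 2 ≤ (2 * W2) ^ 2 := pow_le_pow_left₀ hV0 h2 2
    push_cast at hi
    nlinarith [hi, hsq, influence_nonneg i p]

/-- **`AA_Q` for at most two queries holds with the optimal exponent `c = 2`** (`C = 1/9216`): for every quantum
algorithm making `1 ≤ T ≤ 2` queries, every real polynomial `p` with its acceptance probabilities as cube values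
and `Var[p] ≥ ε > 0`, some variable has `(1/9216)·(ε/T)² ≤ Inf_i[p]` — the hypothesis shape of
`QueryRestrict.quantumQuerySimulable_of_aaQuery` / `QueryPathBridge.pathBound_of_aaQuery_of_bridge` on the
sub-class `T ≤ 2`, improving the tree's DFKO-based `aaQuery_of_queries_le 2` from `ε^a/2^{4C}` to `ε²`.
[cite: AaronsonAmbainis2014, Conj. 6] [cite: ODonnell2014, Thm. 9.21] -/
theorem aaQuery_of_queries_le_two :
    ∃ (c : ℕ) (C : ℝ), 0 < C ∧ ∀ (N : ℕ) (Q : QQueryAlg N) (p : MvPolynomial (Fin N) ℝ) (ε : ℝ),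
      Q.queries ≤ 2 → 1 ≤ Q.queries → (∀ x, evalBool p x = Q.acceptProb x) → 0 < ε → ε ≤ boolVariance p →
        ∃ i : Fin N, C * (ε / Q.queries) ^ c ≤ influence i p := by
  refine ⟨2, 1 / 9216, by norm_num, fun N Q p ε hT2 hT1 hp hε hv => ?_⟩
  rcases Nat.eq_zero_or_pos N with hN0 | hN
  · exfalso
    subst hN0
    have h0 : boolVariance p = 0 := by
      unfold boolVariance boolAvg
      rw [Fintype.sum_unique, Fintype.sum_unique]
      simp
    linarith
  have hε2 : ε ^ 2 ≤ boolVariance p ^ 2 := pow_le_pow_left₀ hε.le hv 2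
  rcases Nat.lt_or_ge Q.queries 2 with hlt | hge
  · -- `T = 1`
    have hT : Q.queries = 1 := by omega
    obtain ⟨i, hi⟩ := aaQuery_one_query_levels hN Q hT p hp
    refine ⟨i, ?_⟩
    rw [hT]; push_cast
    nlinarith [hi, hε2, influence_nonneg i p]
  · -- `T = 2`
    have hT : Q.queries = 2 := by omega
    obtain ⟨i, hi⟩ := aaQuery_two_queries hN Q hT p hp
    refine ⟨i, ?_⟩
    rw [hT]; push_cast
    nlinarith [hi, hε2, influence_nonneg i p]

end Summit.QuantumAdvantage.QuantumAdvantage.Theorems.SosSandwich.LevelTwoRung
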